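import Literature.AlgebraicGeometry.HodgeTheory.HodgeConjecture
import Literature.AlgebraicGeometry.Motives.FamiliesVHS
import HarnessLib

/-!
# The Hodge conjecture for fourfolds fibred over a surface by surfaces of geometric genus zero
# (Arapura 2022, Cor. 1.5), on real carriers

Family `hodge`, layer `Literature/AlgebraicGeometry/HodgeTheory`. A KNOWN CASE of the Hodge
conjecture in the pattern of the sibling files `CubicFourfoldHodgeConjecture`, `LefschetzOneOne`:

* `Arapura2022_hodgeConjecture_pgZeroSurfaceFibration` — D. Arapura, *Hodge cycles and the Leray
  filtration*, Pacific J. Math. 319 (2022) 233–258 (arXiv:2103.05038), Corollary 1.5, verbatim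
  (materialised text p. 5): "Suppose that `dim X = 4`, and `dim Y = 2`, and the general fibre of
  `f : X → Y` is a surface with `p_g = 0`. Then the Hodge conjecture holds for `X`." Standing
  hypotheses of §1 (ibid. p. 3): "let us suppose that `f : X → Y` is a surjective morphism with
  connected fibres between smooth projective varieties. We suppose also that `dim Y < dim X`."
  Proof in print: relative Hilbert scheme spreads a divisor basis of `H²(X_y, ℚ)` (Lefschetz
  `(1,1)` on the fibre, `p_g = 0`) into relative divisors `𝒵_i`, so that after shrinking `U`,
  `H²(U, R²f_*ℚ) = ⊕ H²(U) ∪ [𝒵_i]`, and the Leray criterion Cor. 1.4 / Thm. 1.2 applies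
  (Jannsen's theorem for `X ∖ V`, decomposition theorem over `U`). It recovers Conte–Murre
  (uniruled fourfolds) for conic-bundle-type fibrations.

Requested by the grounding of route `HodgeConjecture/NoetherLefschetzOneUp`, support item
`LevelZeroNets` (stmt-HodgeConjecture-11602): that item is this fact at `Y = ℙ²_ℂ` with the
conclusion weakened to "algebraic ⊔ vertical" — modulo the passage from "fibres over a dense open
set of `ℂ`-points are geometrically irreducible" (the item's hypothesis) to "all fibres connected"
(Stein factorisation / Zariski connectedness over the normal base `ℙ²`, Hartshorne III 11.3–11.5),
which is NOT supplied here.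

## Rendering and faithfulness

* `X`, `Y` range over `ℂ`-schemes with `Motives.IsSmoothProjective 4 X`, `Motives.IsSmoothProjective 2 Y`
  ("smooth projective varieties", `dim X = 4`, `dim Y = 2`; geometrically irreducible by the
  tree's definition, as varieties are in the source).
* "surjective morphism with connected fibres": `f : X ⟶ Y` a morphism of `ℂ`-schemes whose
  underlying continuous map is surjective and has preconnected point-fibres `f⁻¹{y} ⊆ |X|` (the
  underlying space of the scheme-theoretic fibre `X_y` is homeomorphic to `f⁻¹{y}`, Stacks 01JT, so
  this is connectedness of `X_y`; nonempty by surjectivity).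
* "the general fibre is a surface with `p_g = 0`": there is a Zariski-closed `T ⊊ |Y|` such that
  for every `ℂ`-point `s` of `Y` off `T` the fibre `X_s = fiberOver f s` is a smooth projective
  surface admitting a Hodge model with `h^{2,0}(X_s) = dim H^{2,0} ⊂ H²(X_s(ℂ); ℂ) = 0` — the same
  rendering as the route items of `NoetherLefschetzOneUp` (Hodge numbers do not depend on the Hodge
  model: `hodgePQ_independent_of_hodgeModel`, `HodgeModelExistence`).
* "the Hodge conjecture holds for `X`": every rational class of Hodge type `(p,p)` in
  `H²ᵖ(X(ℂ); ℂ)` lies in `algebraicClasses X p`, for every `p` — the cycle conjunct of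
  `HodgeConjectureFor 4 X` (the model conjunct is the separate theorem `nonempty_hodgeModel`).
* Upper bound: an instance of the summit statement (`…_of_hodgeConjectureFor`), so nothing
  stronger than the Hodge conjecture is claimed.

## References

* [Arapura2022] D. Arapura, Hodge cycles and the Leray filtration, Pacific J. Math. 319 (2022)
  233–258, doi:10.2140/pjm.2022.319.233, arXiv:2103.05038 — Cor. 1.5 p. 5, §1 p. 3 (text read).
* [ConteMurre1978] A. Conte, J. P. Murre, Math. Ann. 238 (1978) 79–88 (recovered case; cite-only).
* [Deligne2000] P. Deligne, The Hodge conjecture (Clay, 2000), §1.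
-/

noncomputable section

namespace Literature.AlgebraicGeometry.HodgeTheory

section HodgeTheory

/-! ### The named fact -/

/-- **The Hodge conjecture for a fourfold fibred over a surface by surfaces of geometric genus
zero (Arapura 2022, Cor. 1.5).** Pacific J. Math. 319 (2022), p. 5: "Corollary 1.5. Suppose that
`dim X = 4`, and `dim Y = 2`, and the general fibre of `f : X → Y` is a surface with `p_g = 0`.
Then the Hodge conjecture holds for `X`." with the standing hypotheses of §1, p. 3: "`f : X → Y`
is a surjective morphism with connected fibres between smooth projective varieties". Rendering:
`X` smooth projective of dimension `4`, `Y` smooth projective of dimension `2` over `ℂ`,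
`f : X ⟶ Y` surjective on points with preconnected point-fibres, and off a proper Zariski-closed
`T ⊆ |Y|` the fibres over `ℂ`-points are smooth projective surfaces with `h^{2,0} = 0`; then every
rational `(p,p)`-class in `H²ᵖ(X(ℂ); ℂ)` lies in `algebraicClasses X p`. Grounds
`Summit.HodgeConjecture.HodgeConjecture.Theses.NoetherLefschetzOneUp.LevelZeroNets`
(`Y = ℙ²`, conclusion weakened; the connected-fibres clause must be derived from the item's
generic geometric irreducibility by Stein factorisation, not supplied here).
[cite: Arapura2022, Cor. 1.5 (p. 5) and §1 (p. 3)] -/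
def Arapura2022_hodgeConjecture_pgZeroSurfaceFibration : Prop :=
  ∀ ⦃X Y : Motives.SchemeOver ℂ⦄ (f : X ⟶ Y),
    Motives.IsSmoothProjective 4 X → Motives.IsSmoothProjective 2 Y →
    Function.Surjective f.left.base →
    (∀ y : Y.left, IsPreconnected (f.left.base ⁻¹' {y})) →
    (∃ T : Set Y.left, IsClosed T ∧ T ≠ Set.univ ∧
      ∀ s : Motives.AlgPoints Y ℂ, s.pt ∉ T →
        Motives.IsSmoothProjective 2 (Motives.fiberOver f s) ∧
        ∃ A : HodgeModel 2 (Motives.fiberOver f s), Module.finrank ℂ ↥(A.hodgePQ 2 2 0) = 0) →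
    ∀ (p : ℕ) (c : Literature.AlgebraicTopology.SingularHomology.singularCohomology ℂ ℂ
        (Motives.ComplexPoints X) (2 * p)),
      IsRationalClass c → IsOfHodgeType 4 X (2 * p) p p c → c ∈ algebraicClasses X p

/-! ### Upper bound: the fact is an instance of the Hodge conjecture -/

/-- The Hodge conjecture for all smooth projective varieties implies Arapura's corollary: it is
its instance on the total space `X`. [cite: Deligne2000, §1] -/
theorem Arapura2022_hodgeConjecture_pgZeroSurfaceFibration_of_hodgeConjectureFor
    (h : ∀ ⦃n : ℕ⦄ ⦃X : Motives.SchemeOver ℂ⦄, Motives.IsSmoothProjective n X → HodgeConjectureFor n X) :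
    Arapura2022_hodgeConjecture_pgZeroSurfaceFibration :=
  fun _ _ _ hX _ _ _ _ p c hc hpp ↦ (h hX).2 p c hc hpp

/-! ### Span form in codimension two (the spelling used by route items) -/

/-- **Span form, `p = 2`**: under the hypotheses of Arapura's Cor. 1.5 the `ℂ`-span of the
rational `(2,2)`-classes of `X` is contained in `algebraicClasses X 2` (`Submodule.span_le`).
[cite: Arapura2022, Cor. 1.5 (p. 5)] -/
theorem span_rational_hodgeTwoTwo_le_algebraicClasses_of_pgZeroSurfaceFibration
    (h : Arapura2022_hodgeConjecture_pgZeroSurfaceFibration)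
    {X Y : Motives.SchemeOver ℂ} (f : X ⟶ Y)
    (hX : Motives.IsSmoothProjective 4 X) (hY : Motives.IsSmoothProjective 2 Y)
    (hf : Function.Surjective f.left.base)
    (hconn : ∀ y : Y.left, IsPreconnected (f.left.base ⁻¹' {y}))
    (hgen : ∃ T : Set Y.left, IsClosed T ∧ T ≠ Set.univ ∧
      ∀ s : Motives.AlgPoints Y ℂ, s.pt ∉ T →
        Motives.IsSmoothProjective 2 (Motives.fiberOver f s) ∧
        ∃ A : HodgeModel 2 (Motives.fiberOver f s), Module.finrank ℂ ↥(A.hodgePQ 2 2 0) = 0) :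
    Submodule.span ℂ {c : Literature.AlgebraicTopology.SingularHomology.singularCohomology ℂ ℂ
        (Motives.ComplexPoints X) (2 * 2) | IsRationalClass c ∧ IsOfHodgeType 4 X (2 * 2) 2 2 c} ≤
      algebraicClasses X 2 :=
  Submodule.span_le.mpr fun c hc ↦ h f hX hY hf hconn hgen 2 c hc.1 hc.2

end HodgeTheory

end Literature.AlgebraicGeometry.HodgeTheory

end
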